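import Summits.Langlands.Langlands.Theses.IrreducibilityBySelfDuality
import Summits.Langlands.Langlands.Theorems.IrreducibilityBySelfDualityWeakAbelianSummandHecke
import Summits.Langlands.Langlands.Theorems.IrreducibilityBySelfDualityIrreducibleOffSectorOpenRegions
import HarnessLib

/-!
# `IrreducibleOffSector` from its open regions, on the route's declarations
(crux stmt-Langlands-14329 `IrreducibilityBySelfDuality.IrreducibleOffSector`, line `Sketch`;
`--supports` file; imports the route module, so it is NOT for use inside `closes` — the structural
statement is `irreducibleOffSector_text_of_open_regions` of `…IrreducibleOffSectorOpenRegions`)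

`IrreducibleOffSector_of_open_regions`: the crux BY NAME from the route's printed-input items
`GaloisRepOfRegularAlgebraic` (i2), `PairLBoundaryJS` (i4), `HeckeEigenvalueField` (i6) — taken by
name, definitionally their texts —, the PROVED item `WeakAbelianSummandHecke` (discharged here by
`WeakAbelianSummandHecke_proof`), Böckle–Hui 2025 Thm. 1.2 (`isIrreducible_galoisRep_gl3_totallyReal`),
the conjecture Buzzard–Gee 3.1.6 for L-algebraic cuspidal `GL_2`, and the four open regions `H3irr`
(rank 3, irregular), `H3esd` (rank 3, `K` neither totally real nor CM, regular essentially self-dual),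
`H4att` (rank `≥ 4`, `K` totally real or CM, regular: irreducibility of the attached representation),
`H4rest` (rank `≥ 4`, irregular or `K` neither totally real nor CM).  This is the certified map of what remains of the crux after the children of
leads 0/c1/c2, in the route's own vocabulary.

References: G. Böckle, C.-Y. Hui, Math. Ann. 393 (2025); K. Buzzard, T. Gee, LMS LNS 414 (2014),
Conj. 3.1.6; D. Ramakrishnan (2008), §0.
-/

noncomputable section

set_option linter.dupNamespace false

open scoped NumberField
open Filter IsDedekindDomain NumberField
open Literature.NumberTheory.Automorphic Literature.NumberTheory.GaloisRepresentations
open Summit.Langlands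
open Summit.Langlands.Langlands.Theses.IrreducibilityBySelfDuality

namespace Summit.Langlands.Langlands.Theorems.IrreducibleOffSector

/-- **`IrreducibleOffSector` from the route's inputs, Buzzard–Gee 3.1.6 for `GL_2`, and its three
open regions.**  Given the route items `GaloisRepOfRegularAlgebraic`, `PairLBoundaryJS`,
`HeckeEigenvalueField` (printed inputs, by name), Böckle–Hui 2025 Thm. 1.2 (named fact), the
conjecture that L-algebraic cuspidal `π` on `GL_2` are L-arithmetic at unramified places (Buzzard–Gee
Conj. 3.1.6), and the open regions `H3irr` (rank 3, irregular `π`), `H3esd` (rank 3, `K` neither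
totally real nor CM, `π` regular and essentially self-dual at Satake level), `H4att` (rank `≥ 4`, `K`
totally real or CM, `π` regular: irreducibility of the representation attached by lang.S27 to a
regular algebraic `π'`) and `H4rest` (rank `≥ 4`, the rest), the crux `IrreducibleOffSector` holds (`irreducibleOffSector_text_of_open_regions`, with the proved
item `WeakAbelianSummandHecke` discharged by `WeakAbelianSummandHecke_proof`).
[cite: BockleHui2025, Theorem 1.1 and Theorem 1.2] [cite: BuzzardGeeLMS2014, Conj. 3.1.6] -/
theorem IrreducibleOffSector_of_open_regions (i2 : GaloisRepOfRegularAlgebraic) (i4 : PairLBoundaryJS)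
    (i6 : HeckeEigenvalueField) (hBH : isIrreducible_galoisRep_gl3_totallyReal)
    (hLA2 : ∀ (K : Type) [Field K] [NumberField K] (hcpt : isCompact_glFiniteIntegralLevel 2 K)
      (π : CuspidalAutomorphicRepData 2 K hcpt), π.1.IsLAlgebraic →
        ∃ E : Subfield ℂ, FiniteDimensional ℚ E ∧
          ∀ᶠ v in cofinite, ∀ α : Multiset ℂ, π.1.HasSatakeParamAt v α → ∀ i ≤ 2, α.esymm i ∈ E)
    (H3irr : ∀ (K : Type) [Field K] [NumberField K] (hcpt : isCompact_glFiniteIntegralLevel 3 K)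
      (π : CuspidalAutomorphicRepData 3 K hcpt), π.1.IsLAlgebraic →
        (¬ ∃ T : InfinityType K 3, π.1.HasInfinityType T ∧ T.IsRegular) →
          ∀ (ℓ : ℕ) [Fact ℓ.Prime] (ι : PadicAlgCl ℓ ≃+* ℂ) (ρ : FramedGaloisRep K (PadicAlgCl ℓ) 3),
            (∀ᶠ v in cofinite, SatakeFrobCompatibleAt ι π.1 ρ v) → ρ.toGaloisRep.IsIrreducible)
    (H3esd : ∀ (K : Type) [Field K] [NumberField K], ¬ IsTotallyReal K → ¬ IsCMField K →
      ∀ (h1 : isCompact_glFiniteIntegralLevel 1 K) (hcpt : isCompact_glFiniteIntegralLevel 3 K)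
        (π : CuspidalAutomorphicRepData 3 K hcpt), π.1.IsLAlgebraic →
          (∃ T : InfinityType K 3, π.1.HasInfinityType T ∧ T.IsRegular) →
            (∃ η : CuspidalAutomorphicRepData 1 K h1, ∀ᶠ v in cofinite,
              ∀ α : Multiset ℂ, π.1.HasSatakeParamAt v α →
                ∃ c : ℂ, η.1.HasSatakeParamAt v {c} ∧ α.map (fun a => a⁻¹) = α.map (fun a => c * a)) →
              ∀ (ℓ : ℕ) [Fact ℓ.Prime] (ι : PadicAlgCl ℓ ≃+* ℂ) (ρ : FramedGaloisRep K (PadicAlgCl ℓ) 3),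
                (∀ᶠ v in cofinite, SatakeFrobCompatibleAt ι π.1 ρ v) → ρ.toGaloisRep.IsIrreducible)
    (H4att : ∀ (n : ℕ), 4 ≤ n → ∀ (K : Type) [Field K] [NumberField K], (IsTotallyReal K ∨ IsCMField K) →
      ∀ (hcpt : isCompact_glFiniteIntegralLevel n K) (π' : CuspidalAutomorphicRepData n K hcpt),
        π'.1.IsRegularAlgebraic →
          ∀ (ℓ : ℕ) [Fact ℓ.Prime] (ι : PadicAlgCl ℓ ≃+* ℂ) (r : FramedGaloisRep K (PadicAlgCl ℓ) n),
            r.toGaloisRep.IsSemisimple →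
              (∀ (v : HeightOneSpectrum (𝓞 K)) (β : Multiset ℂ), π'.1.HasSatakeParamAt v β →
                ((ℓ : ℕ) : 𝓞 K) ∉ v.asIdeal →
                  r.IsUnramifiedAt v ∧ r.HasFrobCharpolyAt v (arithFrobPolyOfSatake ι v.residueCard n β)) →
              r.toGaloisRep.IsIrreducible)
    (H4rest : ∀ (n : ℕ), 4 ≤ n → ∀ (K : Type) [Field K] [NumberField K]
      (hcpt : isCompact_glFiniteIntegralLevel n K) (π : CuspidalAutomorphicRepData n K hcpt),
        π.1.IsLAlgebraic →
          ¬ ((IsTotallyReal K ∨ IsCMField K) ∧ ∃ T : InfinityType K n, π.1.HasInfinityType T ∧ T.IsRegular) →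
            ∀ (ℓ : ℕ) [Fact ℓ.Prime] (ι : PadicAlgCl ℓ ≃+* ℂ) (ρ : FramedGaloisRep K (PadicAlgCl ℓ) n),
              (∀ᶠ v in cofinite, SatakeFrobCompatibleAt ι π.1 ρ v) → ρ.toGaloisRep.IsIrreducible) :
    IrreducibleOffSector :=
  irreducibleOffSector_text_of_open_regions (fun hcpt => i2 _ _ hcpt) hBH WeakAbelianSummandHecke_proof
    i6 i4 hLA2 H3irr H3esd H4att H4rest

end Summit.Langlands.Langlands.Theorems.IrreducibleOffSector

end
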